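import Mathlib
import HarnessLib
import HarnessLib.Audit
import Summits.MatrixMultiplication.Statement
import Literature.Computability.AlgebraicComplexity.CohnUmansTPP
import Literature.RepresentationTheory.FiniteGroups.WedderburnBlocks
import Summits.MatrixMultiplication.MatrixMultiplication.Theorems.PauliSmithLocalisationSuperquadraticInfinitelyOften
import HarnessLib.Audit.Status.Attr

/-!
Route: ProbeRankScaling

DORMANT since 2026-08-22T04:40:46Z (reconciler: no traction for 5.1 d (last activity item-evidence-added at 2026-08-17T02:25:55Z); parked, not closed — `ledger route dormant route-MatrixMultiplication-ProbeRankScaling --off` to reactiva) — unstaffed, not closed; items shared with open routes are served there. `ledger route dormant <id> --off` reactivates.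

# Route ProbeRankScaling — beat the one-leg law n³/ρ polynomially at probe rank ρ = √n — the
scale-one-half threshold for ω > 2 (refutation line)

REFUTATION line (targets ¬MatrixMultiplication; realises cards one-leg-probe-rank-law (spine) and
probe-entanglement-threshold).
Give every term u_l ⊗ v_l ⊗ w_l of a bilinear algorithm ⟨n,n,n⟩ = Σ_l u_l ⊗ v_l ⊗ w_l its PROBE
RANKS (matrix ranks of
u_l, v_l, w_l ∈ M_n; GL³-invariant) and let R_ρ(n) be the least number of terms when all probe ranks
are ≤ ρ. The ONE-LEG
LAW Σ_l rank(u_l) ≥ n³ (support OneLegLaw) gives R_ρ(n) ≥ n³/ρ at every ρ. X = HalfScaleBeat: "at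
scale ρ = √n the one-leg
law is not tight by a polynomial factor" — there is δ > 0 such that for infinitely many n every
decomposition of ⟨n,n,n⟩
over ℂ whose probes all have matrix rank ≤ √n has at least n^{5/2+δ} terms. It suffices: if ω(ℂ) =
2, Kronecker products
of a base algorithm ⟨√n⟩ of rank n^{1+o(1)} with the schoolbook algorithm give scale-√n
decompositions with n^{5/2+o(1)}
terms (scale threshold theorem = the Assembly), so X → ω ≥ 2 + 2δ → ¬(ω = 2).
Lean: `∃ δ : ℝ, 0 < δ ∧ ∀ n₀ : ℕ, ∃ n : ℕ, n₀ ≤ n ∧ ∀ (r : ℕ) (w u v : Fin r → Fin n × Fin n → ℂ),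
Literature.Computability.AlgebraicComplexity.matMulTensor ℂ n n n = ∑ l,
Literature.Computability.AlgebraicComplexity.triad (w l) (u l) (v l) → (∀ l, (Matrix.of
(Function.curry (w l))).rank ^ 2 ≤ n ∧ (Matrix.of (Function.curry (u l))).rank ^ 2 ≤ n ∧ (Matrix.of
(Function.curry (v l))).rank ^ 2 ≤ n) → (n : ℝ) ^ ((5 : ℝ) / 2 + δ) ≤ (r : ℝ)`

## Assembly
Scale-one-half threshold theorem (provable now from the cone, given the supports): assume ω(ℂ) = 2
and HalfScaleBeat with
δ. Since ω = sInf of the admissible exponents < 2+δ, some β < 2+δ is admissible: R(⟨m,m,m⟩) ≤ C·m^β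
eventually. For large n
put m = ⌊√n⌋, q = ⌈n/m⌉; a rank-attaining decomposition of ⟨m⟩ (tensorRank is a minimum over finite
index types),
KroneckerClosure with the schoolbook decomposition of ⟨q⟩ (tensorRank_matMulTensor_le, all probes
rank 1) and
zero-padding from ⟨mq⟩ down to ⟨n⟩ give a decomposition of ⟨n,n,n⟩ with probe ranks ≤ m ≤ √n and ≤ C
m^β (n/m+1)³ =
O(n^{3/2+β/2}) terms; as 3/2+β/2 < 5/2+δ this contradicts HalfScaleBeat at the n ≥ n₀ it provides.
Hence HalfScaleBeat →
ω ≠ 2, i.e. ¬MatrixMultiplication (MatrixMultiplication_iff). Real-exponent bookkeeping + two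
support lemmas; no new idea.

Rationale: WHY THIS LINE. The card's flattening — split ONLY the first leg of ⟨n,n,n⟩ into row and column index
— turns the tensor into an n³×n³
permutation matrix while a term flattens to rank ≤ rank(u_l), so Σ_l rank(u_l) ≥ n³ on each leg
(tight on schoolbook,
Strassen, Strassen^{⊗k}); hence R_ρ(n) ≥ n³/ρ, and on the host side |X||Y||Z| ≤ Σ_χ χ(1)⁴ for every
TPP triple
(Cohn–Umans algorithms with schoolbook inside the Wedderburn blocks are exactly probe-rank-≤-d_max
designs). Planning found
the card's ω-lever dead as filed: Pan's two-fold aggregation (Pan1984 (4.1)–(4.3), block-paired: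
R_2(2s) ≤ 4(s³+3s²), all
probes of rank ≤ 2 — checked term by term) and Kronecker closure of the filtration (probe ranks
multiply) give R_{2^k}(n) ≤
(1+o(1)) n³/2^k, so at CONSTANT probe rank the one-leg law is asymptotically tight whatever ω is,
and the companion card's
threshold theorem F3 can never fire (recorded as support AggregationSaturation, negative knowledge).
The repair is to let
the probe rank grow polynomially: the SCALE PROFILE σ(θ) := limsup log R_{n^θ}(n)/log n is convex
and non-increasing
(Kronecker closure, Fekete), squeezed between the one-leg chord 3−θ and the recursion chord
3−θ(3−ω); ω = 2 iff the two
chords coincide; non-saturation σ(θ) > 3−θ propagates upward in θ and yields ω ≥ 2 + (σ(θ)−3+θ)/θ,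
while "∃θ<1 with
σ(θ) > 3−θ" is merely ω > 2 restated — so the thesis FIXES θ = 1/2, where σ(1/2) > 5/2 is a genuine
strengthening of ω > 2
(implied only by ω > 5/2; known: 5/2 ≤ σ(1/2) ≤ 3 − (3−2.3714)/2 = 2.686,
AlmanDuanVassilevskaWilliamsXuXuZhou2025 via
recursion; Pan powers are useless at this scale, block size 4). Imported areas: restricted-model
lower bounds (Miller 1975
stability model, Raz2003 bounded coefficients) with Schmidt rank of the probes as the restriction
(quantum-information
"entanglement of the measurement"), Pan's aggregation theory (Pan1978, Pan1984, SchwartzZwecher2026)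
as the saturating
designs to be excluded, and subadditivity/convexity bookkeeping; what no prior route does:
BorderRankLowerBound asks for
unrestricted superquadratic (border) rank, inside the EGOW/cactus ceilings; here the baseline
n^{5/2} is already cubic-order
and the missing factor n^δ must come from RIGIDITY of near-equality in the one-leg law
(near-perfect, near-uniform schemes =
Kronecker-dual block bases, card perfect-schemes-kronecker-dual-bases), a non-determinantal
statement about decompositions.

RANKED CRUXES. #2 HalfScaleBeat (crux) — X itself (card one-leg-probe-rank-law N1' moved from
constant ρ to ρ = √n): ∃δ>0 such that for infinitely many n, every decomposition of ⟨n,n,n⟩ over ℂ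
with all probe ranks (three legs) ≤ √n has ≥ n^{5/2+δ} terms; equivalently σ(1/2) > 5/2.
[difficulty: open-problem] (why it might fail: False if ω = 2 (recursion gives n^{5/2+o(1)}); even
if ω > 2 a non-recursive near-perfect uniform family at block rank √n (a '√n-fold aggregation')
would refute it without touching ω; no tool beyond the flattening itself exists yet.) [Pan1984,
Pan1978, EfremenkoGargOliveiraWigderson2018, Blaser2013, AlmanDuanVassilevskaWilliamsXuXuZhou2025]
#3 ConstantFactorHalfScale (crux) — constant-factor non-saturation at scale one-half, for all large
n: ∃c>0 ∃n₀ ∀n≥n₀, every decomposition of ⟨n,n,n⟩ with all probe ranks ≤ √n has ≥ (1+c)·n^{5/2}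
terms (the one-leg law gives n^{5/2}; recursive designs automatically pay ≥ 2n·n^{3/2} since R(⟨√n⟩)
≥ 2n−1, so only aggregation-like near-perfect uniform schemes are at issue; ω-blind, plausible even
if ω = 2; necessary for HalfScaleBeat in spirit and the first non-flattening bound at a growing
scale). [difficulty: L] (why it might fail: A perfect uniform scheme family (Σ rank u_l = n³ with
all ranks = √n: Kronecker-dual block bases of ℂⁿ⊗M_n) may simply exist at scale 1/2; nothing known
forbids it and small cases (n,ρ,r) = (4,2,32) are open.) [Pan1984, arXiv:1905.10192, Landsberg2017,
HopcroftKerr1971]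
#4 SecondOrderTwo (crux) — Pan's junk has the right order at probe rank two: ∃c>0 ∃n₀ ∀n≥n₀, every
decomposition of ⟨n,n,n⟩ with all probe ranks ≤ 2 has ≥ n³/2 + c·n² terms (one-leg law: ≥ n³/2; Pan
1972/1984: ≤ n³/2 + 3n² for even n). The constant-ρ rung where the rigidity toolkit (pairing
structure of near-perfect rank-2 schemes, counting of forced correction terms) is to be built.
[difficulty: L] (why it might fail: The correction terms might be cancellable to o(n²) (Pan1980
already has n³/2 + 9n²/4 − 3n/2 with transformed variables; SchwartzZwecher2026 keep improving
aggregation constants), or true but needing a classification of near-perfect rank-2 schemes.)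
[Pan1984, Pan1980, SchwartzZwecher2026, Landsberg2017, arXiv:1905.10192]
#9 OneLegLaw (support) — the one-leg law on every leg: if ⟨a,b,c⟩ = Σ_l w_l ⊗ u_l ⊗ v_l (tree
convention: w_l the output probe in M_{a×c}, u_l ∈ M_{a×b}, v_l ∈ M_{b×c}) then abc ≤ Σ_l rank(w_l),
abc ≤ Σ_l rank(u_l), abc ≤ Σ_l rank(v_l). Proof: flatten along {column index of the chosen leg} ∪
{one whole other leg} | {row index} ∪ {remaining leg}: ⟨a,b,c⟩ becomes a permutation matrix of size
abc, a term becomes Σ_{s≤rank} (β_s⊗·)(α_s⊗·)ᵀ of rank ≤ rank of its probe; rank subadditivity.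
[difficulty: provable-now] [Landsberg2017, Blaser2013, BurgisserClausenShokrollahi1997]
#9 ProbeRankBound (support) — R_ρ(n)·ρ ≥ n³: a decomposition of ⟨n,n,n⟩ with r terms whose u-probes
all have rank ≤ ρ has ρ·r ≥ n³ (from OneLegLaw). [difficulty: provable-now] [Landsberg2017,
Blaser2013]
#9 KroneckerClosure (support) — the filtration is closed under Kronecker products and probe ranks
multiply: decompositions of ⟨m,m,m⟩ (r₀ terms) and ⟨q,q,q⟩ (r₁ terms) give one of ⟨mq,mq,mq⟩ with
r₀r₁ terms whose probes are Kronecker products of the factors' probes (rank ≤ product of ranks);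
uses ⟨m⟩⊠⟨q⟩ ≅ ⟨mq⟩ (tree: kroneckerTensor_matMulTensor) and Fin m × Fin q ≃ Fin (m·q). With the
schoolbook factor (all ranks 1) this is the recursion bound R_m(mq) ≤ R(⟨m⟩)·q³ used by the
Assembly; with Pan factors it gives AggregationSaturation. [difficulty: provable-now] [Blaser2013,
ChristandlVranaZuiddam2023, Pan1984]
#9 PanTwoFold (support) — Pan's 1972 two-fold aggregation, block-paired (Pan1984 (4.1)–(4.3) with
m=n=p=s applied to the four pairs of block products of ⟨2s,2s,2s⟩): an explicit decomposition of
⟨2s,2s,2s⟩ with 4(s³+3s²) terms all of whose probes (three legs) have matrix rank ≤ 2 (aggregates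
(x_ij+u_jk)(y_jk+v_ki): two-entry probes; corrections x_ij·Σ_k(y_jk+v_ki), u_jk·y_jk,
Σ_j(x_ij+u_jk)·v_ki: entry / row-sum + column-sum probes). [difficulty: M] [Pan1984, Pan1978,
Pan1980, Landsberg2017]
#9 AggregationSaturation (support) — NEGATIVE KNOWLEDGE (kills the cards' constant-ρ thresholds
N1/N1'): at every constant probe rank 2^k the one-leg law is asymptotically tight — ∀k ∀ε>0, for all
large n there is a decomposition of ⟨n,n,n⟩ with all probe ranks ≤ 2^k and ≤ (1+ε)n³/2^k terms
(k-fold Kronecker power of PanTwoFold with block sizes → ∞, KroneckerClosure, zero-padding ⟨n⟩ ≤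
⟨n'⟩ for n ≤ n' which does not raise probe ranks). [difficulty: M] [Pan1984, Pan1978]
#9 FourthMomentPacking (support) — BY-PRODUCT for the host programme (card (C2); refines
CohnUmans2003 Lemma 3.1 and Neumann2011 Obs. 4.1): if a finite group G realizes ⟨n,m,p⟩ (TPP) and
ℂ[G] ≃ Π_i M_{d_i}(ℂ), then nmp ≤ Σ_i d_i⁴. Proof: the Cohn–Umans embedding writes ⟨n,m,p⟩ as a sum
over blocks i of d_i³ triads whose probes are matrices (x,y) ↦ φ(s_x t_y⁻¹)_i[a,b] = Σ_c
φ(s_x)_i[a,c] φ(t_y⁻¹)_i[c,b] of rank ≤ d_i; apply OneLegLaw (u-leg). Consequences recorded, not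
filed: abelian/torus hosts certify nothing (Σd⁴ = cost), and with CU03 Thm 4.1 (tree:
rpow_omega_le_sum_blockDegrees_rpow) irreps that can ever carry ω → 2 satisfy d_max ≥
|G|^{1/4−o(1)}. [difficulty: M] [CohnUmans2003, BlasiakCohnGrochowPrattUmans2024, Neumann2011,
HedtkeMurthy2012]

TWO-LAYER PLAN. Foreseen glued splits, none filed now (k ≤ 3, depth 1): HalfScaleBeat ⇐
NearPerfectStructure (a scale-√n decomposition
with ≤ n^{5/2+δ} terms has, by OneLegLaw counting, a (1−o(1))-fraction of its one-leg rank budget in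
terms of rank ≥
n^{1/2−2δ} whose term-flattenings are in near-direct-sum position) → NoNearKroneckerDualBases
(n^{5/2+δ} Kronecker-structured
subspaces β⊗w of ℂⁿ⊗M_n cannot tile the permutation matrix in near-direct-sum position with
Kronecker-structured duals) →
HalfScaleBeat. SecondOrderTwo ⇐ PairingStructure (a rank-≤2 scheme with n³/2 + o(n²) terms pairs
almost all principal
triples (i,j,k) two at a time, Pan-style) → ForcedCorrections (any such pairing leaves ≥ c·n²
uncancelled correction
classes) → SecondOrderTwo. ConstantFactorHalfScale ⇐ StrictOneLeg (no perfect uniform scheme: ρ·r >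
n³ whenever 2 ≤ ρ < n)
→ Stability (near-equality forces near-perfect-uniform structure) → ConstantFactorHalfScale.

KILL CRITERIA. (i) A scale-√n family with (1+o(1))·n^{5/2} terms (¬ConstantFactorHalfScale: a
'√n-fold aggregation' or perfect uniform
Kronecker-dual bases at block rank √n) → close `refuted:ConstantFactorHalfScale` (HalfScaleBeat is
then hopeless in
practice; hand the construction to card perfect-schemes-kronecker-dual-bases as a positive result).
(ii) ¬HalfScaleBeat
proved (σ(1/2) = 5/2) → close `refuted:HalfScaleBeat`; note it would itself be remarkable (either ω
= 2-strength recursion or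
a new non-recursive design class). (iii) ω = 2 proved by any route → moot (HalfScaleBeat false).
(iv) SecondOrderTwo refuted
(R_2(n) = n³/2 + o(n²)) → pivot only: drop the rank-4 rung, the toolkit must start at growing scale.
(v) If a refuter shows
HalfScaleBeat ⟸ some standard conjecture weaker than ω > 2.5 fails, re-examine the choice θ = 1/2
(move to θ = 1/3).

NOT DECOMPOSED YET. Other scales θ (the strong form "θ* = 0: only constant scales saturate" and the
weak forms θ → 1 are not filed; θ = 1/2 is
the one genuine, non-tautological strengthening of ω > 2 chosen); the border-rank version of the
filtration (the one-leg
law holds for border decompositions by semicontinuity; every crux has a border analogue); the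
companion card's energy /
nuclear-norm law R·Σ‖u‖²‖v‖²‖w‖² ≥ n⁶; exact small values R_2(3) ∈ [19,23], R_2(4) ∈ [32,56] and the
perfect-uniform test
case (4,2,32) (kit/SAT items for tenure); StrictOneLeg (ρ·R_ρ(n) > n³ for 2 ≤ ρ < n) as an exact
statement; the host-side
corollaries TorusHostVoid and the D^{1/4} window (immediate from FourthMomentPacking +
rpow_omega_le_sum_blockDegrees_rpow;
provers may append them with --supports FourthMomentPacking); zero-padding monotonicity of R_ρ in n
(helper lemma of the
Assembly and of AggregationSaturation, rides with --supports).

CHEAPEST FALSIFIER. Literature/construction check first: does a 'λ-fold aggregation' with junk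
o(n³/λ) exist for λ = λ(n) → ∞ polynomially —
in particular any design with probe ranks ≤ √n and (1+o(1))n^{5/2} terms (Pan1984 §§13–14 aggregate
triplets/4-tuples
only for Disjoint MM and λ-algorithms; SchwartzZwecher2026 / Drevet et al. stay at bounded folds; a
general-λ exact scheme
with O(λ²n²) junk would already refute ConstantFactorHalfScale's analogue below scale 1/3 but NOT at
1/2, where junk λ²n² =
n³ swamps the count)? Second: a SAT/Gröbner run of the rank-≤2-probe Brent system for ⟨4,4,4⟩ with
32 terms (the smallest
open perfect-uniform case; rank-2 probes have 12 parameters each instead of 16) — infeasible ⇒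
evidence for the rigidity
cruxes, feasible ⇒ a rank-32 algorithm for ⟨4,4,4⟩ (bR ≥ 29 does not exclude it) and the rigidity
picture is wrong. I ran
neither (kit not in this seat); the aggregation literature I read (Pan1984 pp. 18–21, Thm 31.1;
Landsberg2017 Thm 4.2.1.1)
contains no growing-fold exact scheme.

NUMBERS. One-leg chord σ(θ) ≥ 3−θ; recursion chord σ(θ) ≤ 3−θ(3−ω₀), ω₀ < 2.3714
(AlmanDuanVassilevskaWilliamsXuXuZhou2025): at θ =
1/2, 2.5 ≤ σ(1/2) ≤ 2.686. Pan powers: R_{2^k}(n) ≤ (n³/2^k)·Π_i(1+6/m_i) for n = Π m_i (m_i even);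
best pure-aggregation
point ≈ n^{2.85} at θ ≈ 0.17 (block 2m ≈ 60), useless for θ ≥ 1/4 where the recursion chord is
lower. Constant ρ: R_1(n) =
n³; n³/2 ≤ R_2(n) ≤ n³/2 + 3n² (n even, Pan1984 (4.1)–(4.3) block-paired; Pan1980: n³/2 + 9n²/4 −
3n/2 with transformed
variables, probe ranks not re-checked); n³/3 ≤ R_3(n) ≤ n³/3 + 6n² − 4n/3 (Pan1978 = Landsberg2017
Thm 4.2.1.1, probes =
three-entry / entry+row+column sums, rank ≤ 3). Small: R_2(2) = 7 (Strassen's probes have ranks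
2,1,1,1,1,1,1; HopcroftKerr1971
/ Winograd1971 for 7), R_2(3) ∈ [19,23] (Bläser 19; HKS census arXiv:1905.10192 lists ⟨3,3,3;23⟩
schemes of profile
14x²+55x, not re-verified), R_2(4) ∈ [32,56] (one-leg; Strassen ⊗ schoolbook). Host side: S_3: max
TPP nmp 8 ≤ Σd⁴ = 18;
A_4: 18 ≤ 84; S_4: 36 ≤ 180; D_10: 12 ≤ 34 (HedtkeMurthy2012 capacities, card data). Items at open:
10 (3 cruxes, 6 support,
1 assembly).

DEFINITION REQUESTS. None required: probe rank is `(Matrix.of (Function.curry (u l))).rank` and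
decompositions are inlined over the tree's
`matMulTensor`/`triad`. Optional convenience notion (not filed): `restrictedRank ρ n` = sInf of r
over decompositions with
all probe ranks ≤ ρ (topic Literature/Computability/AlgebraicComplexity), which would shorten every
statement to
`R_ρ(n)`-form; grounders may request it.

Novelty: Searches (2026-08-15): `lit search --hybrid --source local` ×2 ("trilinear aggregating uniting
canceling …" → Pan1984 =
book:anonnd-untitled-gx93405707 pp. 18–21, 141–145 read; "matrix multiplication scheme ranks of
coefficient matrices types of
terms" → BurgisserClausenShokrollahi1997 pp. 408–412, Landsberg2017 pp. 85, 312, Thm 4.2.1.1 read);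
`lit frontier
MatrixMultiplication --since 2020` (30 rows: KauersMoosbauerWood2026 arXiv:2602.11041 and
SchwartzZwecher2026 arXiv:2508.01748
read pp. 1–4 — aggregation refinements, no probe-rank model; nothing on restricted probe rank); `lit
bridges
MatrixMultiplication --cross any` (30 rows, generic); `lit galaxy search "…coefficient matrices of
bounded rank" / "trilinear
aggregating" --star all` (0 rows returned ×2); remote OpenAlex/S2/arXiv rate-limited (429) and
searchd rc 75 ×3 this
session — remote re-audit requested; plus the two refuter audits already on the cards
(novelty-audit-9: Pan1984 Sec. 4
page-checked, Miller 1975, Raz2003; triage-19: BCGPU24 arXiv:2410.14905 Thm 2.2/p. 12 page-checked,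
zbMATH 'triple product
property' 8 hits, CU03 Cor 8/9).
Nearest prior art found: Pan1984 (4.1)–(4.3), Thm 31.1 and Pan1978 (= Landsberg2017 Thm 4.2.1.1) —
the aggregation designs
that saturate the one-leg law at constant probe rank; hub cards probe-entanglement-threshold
(filtration + constant-ρ
threshold theorem, graded new-combination) and one-leg-probe-rank-law (the law, graded
new-combination); arXiv:1905.10192
(rank profiles of schem  [refs: 2602.11041, 2508.01748, 2410.14905, 1905.10192, book:anonnd-untitled-gx93405707, Pan1984, BurgisserClausenShokrollahi1997, Landsberg2017, KauersMoosbauerWood2026, SchwartzZwecher2026, Raz2003, Pan1978, EfremenkoGargOliveiraWigderson2018, Buczynski2026, CohnUmans2003, Neumann2011]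

Barriers (technique_class: restricted-model-lower-bounds, probe-rank-filtration): - technique_class: restricted-model-lower-bounds, probe-rank-filtration
- Literature.Barriers.MatrixMultiplication.LinearRankMethodBarrier: APPLIES to the baseline — the
one-leg law is a flattening of a reshaped ⟨n,n,n⟩ and certifies exactly n^{3−θ} at scale θ (n² at θ
= 1, inside EGOW2018 Thm 4.4 / Buczyński's 6m−4); every crux asks to BEAT that baseline, so each
needs a non-determinantal ingredient (rigidity of near-equality in rank subadditivity for
Segre-structured summands, counting over the induced families of √n-dimensional row/column spaces);
statements about restricted decompositions are not polynomials vanishing on σ_r, so the barrier does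
not formally bind them — honest form: it is not evaded by a known technique; the bet is that bounded
Schmidt rank of the probes makes combinatorial rigidity available where the full model has none.
- Literature.Barriers.MatrixMultiplication.InfimumNotMinimumBarrier: consistent — all items are
asymptotic in n at a fixed scale; no finite scheme certifies or refutes anything here
(AggregationSaturation even exhibits the infimum-not-minimum phenomenon inside the filtration:
n³/2^k is approached, never attained).
- Literature.Barriers.MatrixMultiplication.QuasirandomBarrier: host side only — FourthMomentPacking
is a sibling constraint on the SMALL-character side (useful irreps need d_max ≥ |G|^{1/4−o(1)}),
consistent with the quasirandom (large minimal degree) obstruction and with NormalizerBarrier /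
NilpotentGroupBarrier / TricoloredS

History (route lifecycle, newest last):
- 2026-08-22T04:40:46Z · DORMANT — reconciler: no traction for 5.1 d (last activity item-evidence-added at 2026-08-17T02:25:55Z); parked, not closed — `ledger route dormant route-MatrixMultiplica (operator:999:3820069)

sub-problem: MatrixMultiplication · status: dormant · opened planner-plancard-MatrixMultiplication-MatrixM-bb40770f-0 2026-08-15T12:11:33Z · rev 1 · ledger route-MatrixMultiplication-ProbeRankScaling
GENERATED by the gate from the ledger (D-0016/17). Provers cite these decls: `theorem foo : Summit.MatrixMultiplication.MatrixMultiplication.Theses.ProbeRankScaling.<Decl> := …` in Summits/MatrixMultiplication/MatrixMultiplication/Theorems/<Name>.lean.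
-/

namespace Summit.MatrixMultiplication.MatrixMultiplication.Theses.ProbeRankScaling

open scoped BigOperators Topology Manifold Classical MeasureTheory ProbabilityTheory Matrix InnerProductSpace ComplexConjugate ContinuousMap
open Filter Set Function TopologicalSpace MeasureTheory

attribute [summit_statement] _root_.MatrixMultiplication

/-- item stmt-MatrixMultiplication-7533 · crux · rank 2 · open · by planner
why it might fail: False if ω = 2 (recursion gives n^{5/2+o(1)}); even if ω > 2 a non-recursive near-perfect uniform family at block rank √n (a '√n-fold aggregation') would refute it without touching ω; no tool beyond the flattening itself exists yet.
sources: Pan1984, Pan1978, EfremenkoGargOliveiraWigderson2018, Blaser2013, AlmanDuanVassilevskaWilliamsXuXuZhou2025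
[crux] X itself (card one-leg-probe-rank-law N1' moved from constant ρ to ρ = √n): ∃δ>0 such that
for infinitely many n, every decomposition of ⟨n,n,n⟩ over ℂ with all probe ranks (three legs) ≤ √n
has ≥ n^{5/2+δ} terms; equivalently σ(1/2) > 5/2. [difficulty: open-problem] -/
@[route_item "route-MatrixMultiplication-ProbeRankScaling", crux]
def HalfScaleBeat : Prop :=
  ∃ δ : ℝ, 0 < δ ∧ ∀ n₀ : ℕ, ∃ n : ℕ, n₀ ≤ n ∧ ∀ (r : ℕ) (w u v : Fin r → Fin n × Fin n → ℂ), Literature.Computability.AlgebraicComplexity.matMulTensor ℂ n n n = ∑ l, Literature.Computability.AlgebraicComplexity.triad (w l) (u l) (v l) → (∀ l, (Matrix.of (Function.curry (w l))).rank ^ 2 ≤ n ∧ (Matrix.of (Function.curry (u l))).rank ^ 2 ≤ n ∧ (Matrix.of (Function.curry (v l))).rank ^ 2 ≤ n) → (n : ℝ) ^ ((5 : ℝ) / 2 + δ) ≤ (r : ℝ)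

/-- item stmt-MatrixMultiplication-7534 · crux · rank 3 · open · by planner
why it might fail: A perfect uniform scheme family (Σ rank u_l = n³ with all ranks = √n: Kronecker-dual block bases of ℂⁿ⊗M_n) may simply exist at scale 1/2; nothing known forbids it and small cases (n,ρ,r) = (4,2,32) are open.
sources: Pan1984, arXiv:1905.10192, Landsberg2017, HopcroftKerr1971
[crux] constant-factor non-saturation at scale one-half, for all large n: ∃c>0 ∃n₀ ∀n≥n₀, every
decomposition of ⟨n,n,n⟩ with all probe ranks ≤ √n has ≥ (1+c)·n^{5/2} terms (the one-leg law gives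
n^{5/2}; recursive designs automatically pay ≥ 2n·n^{3/2} since R(⟨√n⟩) ≥ 2n−1, so only
aggregation-like near-perfect uniform schemes are at issue; ω-blind, plausible even if ω = 2;
necessary for HalfScaleBeat in spirit and the first non-flattening bound at a growing scale).
[difficulty: L] -/
@[route_item "route-MatrixMultiplication-ProbeRankScaling"]
def ConstantFactorHalfScale : Prop :=
  ∃ c : ℝ, 0 < c ∧ ∃ n₀ : ℕ, ∀ n : ℕ, n₀ ≤ n → ∀ (r : ℕ) (w u v : Fin r → Fin n × Fin n → ℂ), Literature.Computability.AlgebraicComplexity.matMulTensor ℂ n n n = ∑ l, Literature.Computability.AlgebraicComplexity.triad (w l) (u l) (v l) → (∀ l, (Matrix.of (Function.curry (w l))).rank ^ 2 ≤ n ∧ (Matrix.of (Function.curry (u l))).rank ^ 2 ≤ n ∧ (Matrix.of (Function.curry (v l))).rank ^ 2 ≤ n) → (1 + c) * (n : ℝ) ^ ((5 : ℝ) / 2) ≤ (r : ℝ)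

/-- item stmt-MatrixMultiplication-7535 · crux · rank 4 · open · by planner
why it might fail: The correction terms might be cancellable to o(n²) (Pan1980 already has n³/2 + 9n²/4 − 3n/2 with transformed variables; SchwartzZwecher2026 keep improving aggregation constants), or true but needing a classification of near-perfect rank-2 schemes.
sources: Pan1984, Pan1980, SchwartzZwecher2026, Landsberg2017, arXiv:1905.10192
[crux] Pan's junk has the right order at probe rank two: ∃c>0 ∃n₀ ∀n≥n₀, every decomposition of
⟨n,n,n⟩ with all probe ranks ≤ 2 has ≥ n³/2 + c·n² terms (one-leg law: ≥ n³/2; Pan 1972/1984: ≤ n³/2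
+ 3n² for even n). The constant-ρ rung where the rigidity toolkit (pairing structure of near-perfect
rank-2 schemes, counting of forced correction terms) is to be built. [difficulty: L] -/
@[route_item "route-MatrixMultiplication-ProbeRankScaling"]
def SecondOrderTwo : Prop :=
  ∃ c : ℝ, 0 < c ∧ ∃ n₀ : ℕ, ∀ n : ℕ, n₀ ≤ n → ∀ (r : ℕ) (w u v : Fin r → Fin n × Fin n → ℂ), Literature.Computability.AlgebraicComplexity.matMulTensor ℂ n n n = ∑ l, Literature.Computability.AlgebraicComplexity.triad (w l) (u l) (v l) → (∀ l, (Matrix.of (Function.curry (w l))).rank ≤ 2 ∧ (Matrix.of (Function.curry (u l))).rank ≤ 2 ∧ (Matrix.of (Function.curry (v l))).rank ≤ 2) → (n : ℝ) ^ 3 / 2 + c * (n : ℝ) ^ 2 ≤ (r : ℝ)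

/-- item stmt-MatrixMultiplication-10208 · support · rank 9 · closed · proved by Summit.MatrixMultiplication.MatrixMultiplication.Theorems.halfScaleTransfer_proof @ fccf8e6d78b8 (prover) · by planner
[support] transfer / recursion chord at scale one-half, contrapositive form (provable now; together
with SuperquadraticInfinitelyOften it is the scale-one-half threshold theorem of the thesis and
carries the deciding theorem `closes : HalfScaleBeat → HalfScaleTransfer →
SuperquadraticInfinitelyOften → ¬ MatrixMultiplication`): fix δ > 0; if for infinitely many n every
decomposition of ⟨n,n,n⟩ over ℂ whose probes all have rank² ≤ n has ≥ n^{5/2+δ} terms, then m^{2+δ}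
< R(⟨m,m,m⟩) for infinitely many m. Proof: for such n (taken ≥ n₀² and large) put m = ⌊√n⌋ ≥ 1, q =
⌈n/m⌉ ≤ m+2; a rank-attaining decomposition of ⟨m⟩ (Nat.sInf attained: the defining set is non-empty
by tensorRank_le_card) Kronecker the schoolbook decomposition of ⟨q⟩ (Pi.single probes, rank ≤ 1) is
a decomposition of ⟨mq⟩ with R(⟨m⟩)·q³ terms and probe ranks ≤ m (KroneckerClosure); restricting
along Fin n ↪ Fin (mq) (n ≤ mq; matMulTensor and triads restrict entrywise, probes become
submatrices, rank ≤ m, m² ≤ n) gives one of ⟨n⟩, so n^{5/2+δ} ≤ R(⟨m⟩)(m+2)³, i.e. R(⟨m⟩) ≥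
m^{5+2δ}/(m+2)³ > m^{2+δ} once m^{3+δ} > (m+2)³, true for m large. [difficulty: provable-now]
[Blaser2013, Strassen1969, Pan1984] -/
@[route_item "route-MatrixMultiplication-ProbeRankScaling", crux]
def HalfScaleTransfer : Prop :=
  ∀ δ : ℝ, 0 < δ → (∀ n₀ : ℕ, ∃ n : ℕ, n₀ ≤ n ∧ ∀ (r : ℕ) (w u v : Fin r → Fin n × Fin n → ℂ), Literature.Computability.AlgebraicComplexity.matMulTensor ℂ n n n = ∑ l, Literature.Computability.AlgebraicComplexity.triad (w l) (u l) (v l) → (∀ l, (Matrix.of (Function.curry (w l))).rank ^ 2 ≤ n ∧ (Matrix.of (Function.curry (u l))).rank ^ 2 ≤ n ∧ (Matrix.of (Function.curry (v l))).rank ^ 2 ≤ n) → (n : ℝ) ^ ((5 : ℝ) / 2 + δ) ≤ (r : ℝ)) → ∀ n₀ : ℕ, ∃ m : ℕ, n₀ ≤ m ∧ (m : ℝ) ^ (2 + δ) < (Literature.Computability.AlgebraicComplexity.tensorRank (Literature.Computability.AlgebraicComplexity.matMulTensor ℂ m m m) : ℝ)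

/-- item stmt-MatrixMultiplication-7536 · support · rank 9 · closed · proved by Summit.MatrixMultiplication.MatrixMultiplication.Theorems.oneLegLaw_proof @ 95e279b06e10 (prover) · by planner
sources: Landsberg2017, Blaser2013, BurgisserClausenShokrollahi1997
[support] the one-leg law on every leg: if ⟨a,b,c⟩ = Σ_l w_l ⊗ u_l ⊗ v_l (tree convention: w_l the
output probe in M_{a×c}, u_l ∈ M_{a×b}, v_l ∈ M_{b×c}) then abc ≤ Σ_l rank(w_l), abc ≤ Σ_l
rank(u_l), abc ≤ Σ_l rank(v_l). Proof: flatten along {column index of the chosen leg} ∪ {one whole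
other leg} | {row index} ∪ {remaining leg}: ⟨a,b,c⟩ becomes a permutation matrix of size abc, a term
becomes Σ_{s≤rank} (β_s⊗·)(α_s⊗·)ᵀ of rank ≤ rank of its probe; rank subadditivity. [difficulty:
provable-now] -/
@[route_item "route-MatrixMultiplication-ProbeRankScaling"]
def OneLegLaw : Prop :=
  ∀ (a b c r : ℕ) (w : Fin r → Fin a × Fin c → ℂ) (u : Fin r → Fin a × Fin b → ℂ) (v : Fin r → Fin b × Fin c → ℂ), Literature.Computability.AlgebraicComplexity.matMulTensor ℂ a b c = ∑ l, Literature.Computability.AlgebraicComplexity.triad (w l) (u l) (v l) → a * b * c ≤ ∑ l, (Matrix.of (Function.curry (w l))).rank ∧ a * b * c ≤ ∑ l, (Matrix.of (Function.curry (u l))).rank ∧ a * b * c ≤ ∑ l, (Matrix.of (Function.curry (v l))).rank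

/-- item stmt-MatrixMultiplication-7537 · support · rank 9 · closed · proved by Summit.MatrixMultiplication.MatrixMultiplication.Theorems.probeRankBound_proof @ e2c57acbbdcd (prover) · by planner
sources: Landsberg2017, Blaser2013
[support] R_ρ(n)·ρ ≥ n³: a decomposition of ⟨n,n,n⟩ with r terms whose u-probes all have rank ≤ ρ
has ρ·r ≥ n³ (from OneLegLaw). [difficulty: provable-now] -/
@[route_item "route-MatrixMultiplication-ProbeRankScaling"]
def ProbeRankBound : Prop :=
  ∀ (n ρ r : ℕ) (w u v : Fin r → Fin n × Fin n → ℂ), Literature.Computability.AlgebraicComplexity.matMulTensor ℂ n n n = ∑ l, Literature.Computability.AlgebraicComplexity.triad (w l) (u l) (v l) → (∀ l, (Matrix.of (Function.curry (u l))).rank ≤ ρ) → n ^ 3 ≤ ρ * r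

/-- item stmt-MatrixMultiplication-7538 · support · rank 9 · closed · proved by Summit.MatrixMultiplication.MatrixMultiplication.Theorems.kroneckerClosure_proof @ 435cacda3ce6 (prover) · by planner
sources: Blaser2013, ChristandlVranaZuiddam2023, Pan1984
[support] the filtration is closed under Kronecker products and probe ranks multiply: decompositions
of ⟨m,m,m⟩ (r₀ terms) and ⟨q,q,q⟩ (r₁ terms) give one of ⟨mq,mq,mq⟩ with r₀r₁ terms whose probes are
Kronecker products of the factors' probes (rank ≤ product of ranks); uses ⟨m⟩⊠⟨q⟩ ≅ ⟨mq⟩ (tree: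
kroneckerTensor_matMulTensor) and Fin m × Fin q ≃ Fin (m·q). With the schoolbook factor (all ranks
1) this is the recursion bound R_m(mq) ≤ R(⟨m⟩)·q³ used by the Assembly; with Pan factors it gives
AggregationSaturation. [difficulty: provable-now] -/
@[route_item "route-MatrixMultiplication-ProbeRankScaling"]
def KroneckerClosure : Prop :=
  ∀ (m q r₀ r₁ : ℕ) (w u v : Fin r₀ → Fin m × Fin m → ℂ) (w₁ u₁ v₁ : Fin r₁ → Fin q × Fin q → ℂ), Literature.Computability.AlgebraicComplexity.matMulTensor ℂ m m m = ∑ l, Literature.Computability.AlgebraicComplexity.triad (w l) (u l) (v l) → Literature.Computability.AlgebraicComplexity.matMulTensor ℂ q q q = ∑ l, Literature.Computability.AlgebraicComplexity.triad (w₁ l) (u₁ l) (v₁ l) → ∃ (e : Fin (r₀ * r₁) ≃ Fin r₀ × Fin r₁) (w' u' v' : Fin (r₀ * r₁) → Fin (m * q) × Fin (m * q) → ℂ), Literature.Computability.AlgebraicComplexity.matMulTensor ℂ (m * q) (m * q) (m * q) = ∑ l, Literature.Computability.AlgebraicComplexity.triad (w' l) (u' l) (v' l) ∧ ∀ l, (Matrix.of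 (Function.curry (w' l))).rank ≤ (Matrix.of (Function.curry (w (e l).1))).rank * (Matrix.of (Function.curry (w₁ (e l).2))).rank ∧ (Matrix.of (Function.curry (u' l))).rank ≤ (Matrix.of (Function.curry (u (e l).1))).rank * (Matrix.of (Function.curry (u₁ (e l).2))).rank ∧ (Matrix.of (Function.curry (v' l))).rank ≤ (Matrix.of (Function.curry (v (e l).1))).rank * (Matrix.of (Function.curry (v₁ (e l).2))).rank

/-- item stmt-MatrixMultiplication-7539 · support · rank 9 · closed · proved by Summit.MatrixMultiplication.MatrixMultiplication.Theorems.panTwoFold_proof @ ddd5cbf215a8 (prover) · by planner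
sources: Pan1984, Pan1978, Pan1980, Landsberg2017
[support] Pan's 1972 two-fold aggregation, block-paired (Pan1984 (4.1)–(4.3) with m=n=p=s applied to
the four pairs of block products of ⟨2s,2s,2s⟩): an explicit decomposition of ⟨2s,2s,2s⟩ with
4(s³+3s²) terms all of whose probes (three legs) have matrix rank ≤ 2 (aggregates
(x_ij+u_jk)(y_jk+v_ki): two-entry probes; corrections x_ij·Σ_k(y_jk+v_ki), u_jk·y_jk,
Σ_j(x_ij+u_jk)·v_ki: entry / row-sum + column-sum probes). [difficulty: M] -/
@[route_item "route-MatrixMultiplication-ProbeRankScaling"]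
def PanTwoFold : Prop :=
  ∀ s : ℕ, ∃ (w u v : Fin (4 * (s ^ 3 + 3 * s ^ 2)) → Fin (2 * s) × Fin (2 * s) → ℂ), Literature.Computability.AlgebraicComplexity.matMulTensor ℂ (2 * s) (2 * s) (2 * s) = ∑ l, Literature.Computability.AlgebraicComplexity.triad (w l) (u l) (v l) ∧ ∀ l, (Matrix.of (Function.curry (w l))).rank ≤ 2 ∧ (Matrix.of (Function.curry (u l))).rank ≤ 2 ∧ (Matrix.of (Function.curry (v l))).rank ≤ 2

/-- item stmt-MatrixMultiplication-7540 · support · rank 9 · closed · proved by Summit.MatrixMultiplication.MatrixMultiplication.Theorems.aggregationSaturation_proof @ 7621d4dbdbca (prover) · by planner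
sources: Pan1984, Pan1978
[support] NEGATIVE KNOWLEDGE (kills the cards' constant-ρ thresholds N1/N1'): at every constant
probe rank 2^k the one-leg law is asymptotically tight — ∀k ∀ε>0, for all large n there is a
decomposition of ⟨n,n,n⟩ with all probe ranks ≤ 2^k and ≤ (1+ε)n³/2^k terms (k-fold Kronecker power
of PanTwoFold with block sizes → ∞, KroneckerClosure, zero-padding ⟨n⟩ ≤ ⟨n'⟩ for n ≤ n' which does
not raise probe ranks). [difficulty: M] -/
@[route_item "route-MatrixMultiplication-ProbeRankScaling"]
def AggregationSaturation : Prop :=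
  ∀ (k : ℕ) (ε : ℝ), 0 < ε → ∃ n₀ : ℕ, ∀ n : ℕ, n₀ ≤ n → ∃ (r : ℕ) (w u v : Fin r → Fin n × Fin n → ℂ), Literature.Computability.AlgebraicComplexity.matMulTensor ℂ n n n = ∑ l, Literature.Computability.AlgebraicComplexity.triad (w l) (u l) (v l) ∧ (∀ l, (Matrix.of (Function.curry (w l))).rank ≤ 2 ^ k ∧ (Matrix.of (Function.curry (u l))).rank ≤ 2 ^ k ∧ (Matrix.of (Function.curry (v l))).rank ≤ 2 ^ k) ∧ (r : ℝ) ≤ (1 + ε) * (n : ℝ) ^ 3 / 2 ^ k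

/-- item stmt-MatrixMultiplication-7541 · support · rank 9 · closed · proved by Summit.MatrixMultiplication.MatrixMultiplication.Theorems.probeRankScaling_fourthMomentPacking_proof @ 6465552124c4 (prover) · by planner
sources: CohnUmans2003, BlasiakCohnGrochowPrattUmans2024, Neumann2011, HedtkeMurthy2012
[support] BY-PRODUCT for the host programme (card (C2); refines CohnUmans2003 Lemma 3.1 and
Neumann2011 Obs. 4.1): if a finite group G realizes ⟨n,m,p⟩ (TPP) and ℂ[G] ≃ Π_i M_{d_i}(ℂ), then
nmp ≤ Σ_i d_i⁴. Proof: the Cohn–Umans embedding writes ⟨n,m,p⟩ as a sum over blocks i of d_i³ triads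
whose probes are matrices (x,y) ↦ φ(s_x t_y⁻¹)_i[a,b] = Σ_c φ(s_x)_i[a,c] φ(t_y⁻¹)_i[c,b] of rank ≤
d_i; apply OneLegLaw (u-leg). Consequences recorded, not filed: abelian/torus hosts certify nothing
(Σd⁴ = cost), and with CU03 Thm 4.1 (tree: rpow_omega_le_sum_blockDegrees_rpow) irreps that can ever
carry ω → 2 satisfy d_max ≥ |G|^{1/4−o(1)}. [difficulty: M] -/
@[route_item "route-MatrixMultiplication-ProbeRankScaling"]
def FourthMomentPacking : Prop :=
  ∀ (G : Type) [Group G] [Finite G] (n m p : ℕ), Literature.Computability.AlgebraicComplexity.RealizesTPP G n m p → ∀ (r : ℕ) (d : Fin r → ℕ), Nonempty (MonoidAlgebra ℂ G ≃ₐ[ℂ] Literature.RepresentationTheory.FiniteGroups.BlockAlgebraC d) → n * m * p ≤ ∑ i, d i ^ 4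

/-- item stmt-MatrixMultiplication-7992 · support · rank 9 · closed · proved by Summit.MatrixMultiplication.MatrixMultiplication.Theorems.superquadraticInfinitelyOften_proof @ 02436f954f72 (prover) · by planner
[support] glue (provable now): an infinitely-often superquadratic rank lower bound n^{2+δ} <
R(⟨n,n,n⟩) (δ > 0 fixed) contradicts ω(ℂ) = 2 (if sInf = 2 then 2+δ/2 is admissible by csInf_lt_iff
+ upward closure, so R = O(n^{2+δ/2}); nonempty by three_mem_admissibleExponents; if not BddBelow
the sInf is junk 0 ≠ 2). [difficulty: provable-now] -/
@[route_item "route-MatrixMultiplication-ProbeRankScaling", crux]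
def SuperquadraticInfinitelyOften : Prop :=
  (∃ δ : ℝ, 0 < δ ∧ ∀ n₀ : ℕ, ∃ n : ℕ, n₀ ≤ n ∧ (n : ℝ) ^ (2 + δ) < (Literature.Computability.AlgebraicComplexity.tensorRank (Literature.Computability.AlgebraicComplexity.matMulTensor ℂ n n n) : ℝ)) → ¬ MatrixMultiplication

/-- `SuperquadraticInfinitelyOften` holds: proved by `Summit.MatrixMultiplication.MatrixMultiplication.Theorems.superquadraticInfinitelyOften_proof` @ 02436f954f72. -/
theorem SuperquadraticInfinitelyOften_holds : SuperquadraticInfinitelyOften := _root_.Summit.MatrixMultiplication.MatrixMultiplication.Theorems.superquadraticInfinitelyOften_proof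

/-- item stmt-MatrixMultiplication-7542 · assembly · rank 1 · closed · proved by Summit.MatrixMultiplication.MatrixMultiplication.Theorems.probeRankScaling_assembly_proof @ 0f50717ee7ae (prover) · by planner
sources: Blaser2013, Pan1984, Strassen1969
[assembly] HalfScaleBeat → ¬MatrixMultiplication (via KroneckerClosure with the schoolbook factor,
padding, and the definition of ω as an infimum). -/
@[route_item "route-MatrixMultiplication-ProbeRankScaling"]
def Assembly : Prop :=
  HalfScaleBeat → ¬ MatrixMultiplication

/-! D-0027 §2.1 — DECIDING THEOREM (planner-authored via `route open/edit --closes-file`; by planner-rbadge-MatrixMultiplication-ProbeRankS-13bdbc78-g2-0 2026-08-15T16:20:09Z):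
its hypotheses are this route's items and its conclusion the sub-problem Statement (glue_lint), and it elaborates with this file. -/

/-- Route glue (D-0027 §2.1, REFUTATION line): the target `HalfScaleBeat` (X: some `δ > 0` such
that for infinitely many `n` every decomposition of `⟨n,n,n⟩` over `ℂ` whose probes all have
matrix rank `≤ √n` has at least `n^(5/2+δ)` terms), the provable-now transfer lemma
`HalfScaleTransfer` (recursion chord at scale one-half, contrapositive: such a scale-`√n` lower
bound forces `m^(2+δ) < R(⟨m,m,m⟩)` for infinitely many `m` — Kronecker product of a
rank-attaining decomposition of `⟨⌊√n⌋⟩` with the schoolbook algorithm, zero-padding) and the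
shared provable-now support `SuperquadraticInfinitelyOften` (an infinitely-often superquadratic
rank lower bound contradicts `ω(ℂ) = 2`, `ω` being the infimum of the admissible exponents)
refute `MatrixMultiplication` (`ω(ℂ) = 2`). Pure logic: instantiate the transfer at the `δ` of
`HalfScaleBeat` and feed the resulting superquadratic bound to the last support. -/
@[closes "route-MatrixMultiplication-ProbeRankScaling"] theorem closes : HalfScaleBeat → HalfScaleTransfer → SuperquadraticInfinitelyOften → ¬ MatrixMultiplication := by
  rintro ⟨δ, hδ, hX⟩ hT hIO
  exact hIO ⟨δ, hδ, hT δ hδ hX⟩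

end Summit.MatrixMultiplication.MatrixMultiplication.Theses.ProbeRankScaling
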